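import Summits.CriticalPhenomena.PercolationContinuityZ3.Theorems.PercNearOneGluingNoHeavyLowerTailQ44SingleSourceHandshake11

/-!
# The single-source packing off its two cores: odd targets for every sub-family avoiding `{K4, K4s}` and `{Pc, K1, K5/K4}`

Support file for crux `stmt-CriticalPhenomena-4575` (master-family programme, row `Q44`, single-source packing
`g ≥ b1 + h_a`), seat `prim-bnk-1` gen 28; memo `run/shared/lean/prim/prim-l12/FROM-prim-bnk-1-gen28-DECISION-LIST.md` §1–§3.

The full single-source law at source `a` (`K1+K2+K4+K5+K4s+ab+ac`) asks, in every graph fibre, for an odd target for every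
nonempty sub-family `𝒮` of the transversal family of the seven oriented types
`Pb (6,7), Pc (5,7), K1[ab|cy] (11,9), K2[ab|cy] (11,8), K4[ab] (6,8), K5[ab] (6,1), K4s[ay|bc] (8,1)`.
Gen 28 extracted a DECISION LIST from the gen-27 certificate menu and verified it on > 5·10⁷ sub-families (memo §1):
by the set `τ` of types present,

* `Pb ∈ τ, K5 ∉ τ` → a `Pb`-member of maximal size is a private kernel compatible with all seven types;
* `Pc ∈ τ, K1 ∉ τ` → a maximal `Pc`-member (compatible with all types but `K1[ab|cy]`);
* `K5 ∈ τ, Pc ∉ τ` → a maximal `K5`-member (compatible with all types but `Pc`);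
* `τ ⊆ {K1, K2, K4}` → a maximal `K2`- (resp. `K1`-, `K4`-) member;
* `τ ⊆ {Pc, K1, K2, K4s}` → the cell-`ab|cy` handshake (`exists_odd_good_PcK1K2K4s`);

and this list is COMPLETE except for the two cores where no plain or handshake certificate exists (memo §3):
CORE A = `K4 ∈ τ ∧ K4s ∈ τ`, CORE B = `Pc ∈ τ ∧ K1 ∈ τ ∧ (K5 ∈ τ ∨ K4 ∈ τ)` — there the certificate found in every
tested instance is a co-good of size ≤ 3 or a sub-kernel of an `a→b` lobe, whose parity argument is open.

**Theorem (`exists_odd_good_singleSource_offCore`).**  In every graph fibre, every nonempty family of single-source sides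
whose type set avoids CORE A and CORE B has an odd target.  (`exists_odd_good_of_maxType` is the generic plain
certificate.)  Together with the two core statements this is the fibre count of the full single-source law (memo §4).
No sorries, no definitions, standard axioms.
-/

namespace Summit.CriticalPhenomena.PercolationContinuityZ3.Theorems

namespace TwoCopyMono

open Finset FourPointAtoms KernelPeeling Literature.Probability.Percolation

variable {n : ℕ}

/-! ## The generic plain certificate -/

/-- **Plain certificate.**  In a graph fibre, if `𝒮` has a member of type `(h₀ ; l₀)`, every member is compatible with a
kernel of cells `(h₀ ; l₀)` (`upAC (ι S) l₀`, `downBot (ι (M ∖ S)) h₀`), and the only member type that can contain a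
`(h₀;l₀)`-side (cell `≥ h₀`, co-cell `≤ l₀`) is `(h₀;l₀)` itself, then a `(h₀;l₀)`-member of maximal size is a private
compatible kernel, so `𝒮` has an odd target. [this work] -/
theorem exists_odd_good_of_maxType (a b c y : Fin n) (C M : Finset (Sym2 (Fin n)))
    (ι : Finset (Sym2 (Fin n)) → Fin 15) (hι : ∀ T : Finset (Sym2 (Fin n)), prof a b c y ↑(C ∪ T) = pp (ι T))
    (𝒮 : Finset (Finset (Sym2 (Fin n)))) (h𝒮M : ∀ S ∈ 𝒮, S ⊆ M) (h₀ l₀ : Fin 15)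
    (hex : ∃ S ∈ 𝒮, ι S = h₀ ∧ ι (M \ S) = l₀)
    (hcompat : ∀ S ∈ 𝒮, upAC (ι S) l₀ = true ∧ downBot (ι (M \ S)) h₀ = true)
    (hcont : ∀ S ∈ 𝒮, ple h₀ (ι S) = true → ple (ι (M \ S)) l₀ = true → ι S = h₀ ∧ ι (M \ S) = l₀) :
    ∃ T ∈ goods (fun T : Finset (Sym2 (Fin n)) => ι (T ∩ M)), Odd #(𝒮.filter (fun S => S ⊆ T)) := by
  classical
  set κ : Finset (Sym2 (Fin n)) → Fin 15 := fun T => ι (T ∩ M) with hκ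
  have hmono : ∀ A B : Finset (Sym2 (Fin n)), A ⊆ B → ple (κ A) (κ B) = true := fun A B hAB =>
    ple_fibreMap a b c y C ι hι (Finset.inter_subset_inter hAB (subset_refl M))
  have hκS : ∀ S, S ⊆ M → κ S = ι S := fun S hS => by simp only [hκ, Finset.inter_eq_left.2 hS]
  have hκSc : ∀ S : Finset (Sym2 (Fin n)), κ Sᶜ = ι (M \ S) := fun S => by
    simp only [hκ]; congr 1; ext e; simp [Finset.mem_sdiff, Finset.mem_inter, and_comm]
  obtain ⟨S₀, hS₀f, hS₀max⟩ := Finset.exists_max_image (𝒮.filter (fun S => ι S = h₀ ∧ ι (M \ S) = l₀)) Finset.card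
    (by obtain ⟨S, hS, h1, h2⟩ := hex; exact ⟨S, Finset.mem_filter.2 ⟨hS, h1, h2⟩⟩)
  have hS₀ : S₀ ∈ 𝒮 := (Finset.mem_filter.1 hS₀f).1
  have hS₀t : ι S₀ = h₀ ∧ ι (M \ S₀) = l₀ := (Finset.mem_filter.1 hS₀f).2
  have hS₀M : S₀ ⊆ M := h𝒮M S₀ hS₀
  refine exists_odd_good_of_subkernel κ hmono 𝒮 (subset_refl S₀) ?_ ?_
  · intro S hS
    rw [hκSc S₀, hS₀t.2, hκS S₀ hS₀M, hS₀t.1, hκS S (h𝒮M S hS), hκSc S]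
    exact hcompat S hS
  · have hEq : 𝒮.filter (fun S => S₀ ⊆ S) = {S₀} := by
      ext S
      simp only [Finset.mem_filter, Finset.mem_singleton]
      constructor
      · rintro ⟨hS, hsub⟩
        have h1 : ple (ι S₀) (ι S) = true := by
          have h := hmono S₀ S hsub; rwa [hκS S₀ hS₀M, hκS S (h𝒮M S hS)] at h
        have h2 : ple (ι (M \ S)) (ι (M \ S₀)) = true := by
          have h := hmono Sᶜ S₀ᶜ (Finset.compl_subset_compl.2 hsub); rwa [hκSc S, hκSc S₀] at h
        rw [hS₀t.1] at h1; rw [hS₀t.2] at h2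
        have hSt := hcont S hS h1 h2
        exact (Finset.eq_of_subset_of_card_le hsub (hS₀max S (Finset.mem_filter.2 ⟨hS, hSt⟩))).symm
      · rintro rfl; exact ⟨hS₀, subset_refl _⟩
    rw [hEq, Finset.card_singleton]; exact odd_one

/-! ## Tables of the decision list -/

/-- Branch `Pb ∈ τ, K5 ∉ τ`: the `Pb`-kernel `(6;7)` is compatible with all seven types, and the only types that can
contain a `Pb`-side are `Pb` and `K5`. [this work] -/
theorem tables_branch_Pb :
    (∀ q ∈ ({(6, 7), (5, 7), (11, 9), (11, 8), (6, 8), (6, 1), (8, 1)} : Finset (Fin 15 × Fin 15)),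
        upAC q.1 7 = true ∧ downBot q.2 6 = true) ∧
    (∀ q ∈ ({(6, 7), (5, 7), (11, 9), (11, 8), (6, 8), (6, 1), (8, 1)} : Finset (Fin 15 × Fin 15)),
        ple 6 q.1 = true → ple q.2 7 = true → q = (6, 7) ∨ q = (6, 1)) := by
  refine ⟨?_, ?_⟩ <;> decide +kernel

/-- Branch `Pc ∈ τ, K1 ∉ τ`: the `Pc`-kernel `(5;7)` is compatible with all types but `K1[ab|cy]`, and only `Pc` can
contain a `Pc`-side. [this work] -/
theorem tables_branch_Pc :
    (∀ q ∈ ({(6, 7), (5, 7), (11, 9), (11, 8), (6, 8), (6, 1), (8, 1)} : Finset (Fin 15 × Fin 15)), q ≠ (11, 9) →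
        upAC q.1 7 = true ∧ downBot q.2 5 = true) ∧
    (∀ q ∈ ({(6, 7), (5, 7), (11, 9), (11, 8), (6, 8), (6, 1), (8, 1)} : Finset (Fin 15 × Fin 15)),
        ple 5 q.1 = true → ple q.2 7 = true → q = (5, 7)) := by
  refine ⟨?_, ?_⟩ <;> decide +kernel

/-- Branch `K5 ∈ τ, Pc ∉ τ`: the `K5`-kernel `(6;1)` is compatible with all types but `Pc`, and only `K5` can contain a
`K5`-side. [this work] -/
theorem tables_branch_K5 :
    (∀ q ∈ ({(6, 7), (5, 7), (11, 9), (11, 8), (6, 8), (6, 1), (8, 1)} : Finset (Fin 15 × Fin 15)), q ≠ (5, 7) →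
        upAC q.1 1 = true ∧ downBot q.2 6 = true) ∧
    (∀ q ∈ ({(6, 7), (5, 7), (11, 9), (11, 8), (6, 8), (6, 1), (8, 1)} : Finset (Fin 15 × Fin 15)),
        ple 6 q.1 = true → ple q.2 1 = true → q = (6, 1)) := by
  refine ⟨?_, ?_⟩ <;> decide +kernel

/-- Branch `τ ⊆ {K1, K2, K4}`: the `K2`-kernel is compatible with `K1, K2, K4` and private; without `K2` the `K1`-kernel
is compatible with `K1, K4` and private; the `K4`-kernel is compatible with `K4`. [this work] -/
theorem tables_branch_K1K2K4 :
    (∀ q ∈ ({(11, 9), (11, 8), (6, 8)} : Finset (Fin 15 × Fin 15)), upAC q.1 8 = true ∧ downBot q.2 11 = true) ∧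
    (∀ q ∈ ({(11, 9), (11, 8), (6, 8)} : Finset (Fin 15 × Fin 15)),
        ple 11 q.1 = true → ple q.2 8 = true → q = (11, 8)) ∧
    (∀ q ∈ ({(11, 9), (6, 8)} : Finset (Fin 15 × Fin 15)), upAC q.1 9 = true ∧ downBot q.2 11 = true) ∧
    (∀ q ∈ ({(11, 9), (6, 8)} : Finset (Fin 15 × Fin 15)),
        ple 11 q.1 = true → ple q.2 9 = true → q = (11, 9)) ∧
    (upAC 6 8 = true ∧ downBot 8 6 = true) := by
  refine ⟨?_, ?_, ?_, ?_, ?_⟩ <;> decide +kernel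

/-! ## The theorem -/

/-- **The single-source packing off its cores (memo §1–§3).**  Graph fibre `(M, C)` with labelling `ι`; `𝒮` a nonempty
family of sides of the seven single-source types whose type set contains neither CORE A (`K4[ab]` together with
`K4s[ay|bc]`) nor CORE B (`Pc` and `K1[ab|cy]` together with a `K5[ab]`- or `K4[ab]`-side).  Then some good of
`κ T = ι (T ∩ M)` contains an odd number of members of `𝒮`. [this work] -/
theorem exists_odd_good_singleSource_offCore (a b c y : Fin n) (C M : Finset (Sym2 (Fin n)))
    (ι : Finset (Sym2 (Fin n)) → Fin 15) (hι : ∀ T : Finset (Sym2 (Fin n)), prof a b c y ↑(C ∪ T) = pp (ι T))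
    (𝒮 : Finset (Finset (Sym2 (Fin n)))) (hne : 𝒮.Nonempty) (h𝒮M : ∀ S ∈ 𝒮, S ⊆ M)
    (htypes : ∀ S ∈ 𝒮, (ι S, ι (M \ S)) ∈
      ({(6, 7), (5, 7), (11, 9), (11, 8), (6, 8), (6, 1), (8, 1)} : Finset (Fin 15 × Fin 15)))
    (hA : ¬ ((∃ S ∈ 𝒮, (ι S, ι (M \ S)) = (6, 8)) ∧ (∃ S ∈ 𝒮, (ι S, ι (M \ S)) = (8, 1))))
    (hB : ¬ ((∃ S ∈ 𝒮, (ι S, ι (M \ S)) = (5, 7)) ∧ (∃ S ∈ 𝒮, (ι S, ι (M \ S)) = (11, 9)) ∧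
      (∃ S ∈ 𝒮, (ι S, ι (M \ S)) = (6, 1) ∨ (ι S, ι (M \ S)) = (6, 8)))) :
    ∃ T ∈ goods (fun T : Finset (Sym2 (Fin n)) => ι (T ∩ M)), Odd #(𝒮.filter (fun S => S ⊆ T)) := by
  classical
  -- presence predicates
  have hmemP : ∀ S ∈ 𝒮, (ι S, ι (M \ S)) = (6, 7) ∨ (ι S, ι (M \ S)) = (5, 7) ∨ (ι S, ι (M \ S)) = (11, 9) ∨
      (ι S, ι (M \ S)) = (11, 8) ∨ (ι S, ι (M \ S)) = (6, 8) ∨ (ι S, ι (M \ S)) = (6, 1) ∨ (ι S, ι (M \ S)) = (8, 1) := by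
    intro S hS
    have h := htypes S hS
    simp only [Finset.mem_insert, Finset.mem_singleton] at h
    exact h
  have hpair : ∀ S (u v : Fin 15), (ι S, ι (M \ S)) = (u, v) ↔ ι S = u ∧ ι (M \ S) = v := by
    intro S u v; rw [Prod.mk.injEq]
  by_cases h1 : (∃ S ∈ 𝒮, (ι S, ι (M \ S)) = (6, 7)) ∧ ¬ ∃ S ∈ 𝒮, (ι S, ι (M \ S)) = (6, 1)
  · -- branch Pb
    obtain ⟨⟨S₁, hS₁, hS₁t⟩, hno5⟩ := h1
    refine exists_odd_good_of_maxType a b c y C M ι hι 𝒮 h𝒮M 6 7 ⟨S₁, hS₁, (hpair S₁ 6 7).1 hS₁t⟩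
      (fun S hS => tables_branch_Pb.1 _ (htypes S hS)) (fun S hS hle1 hle2 => ?_)
    rcases tables_branch_Pb.2 _ (htypes S hS) hle1 hle2 with h | h
    · exact (hpair S 6 7).1 h
    · exact absurd ⟨S, hS, h⟩ hno5
  · by_cases h2 : (∃ S ∈ 𝒮, (ι S, ι (M \ S)) = (5, 7)) ∧ ¬ ∃ S ∈ 𝒮, (ι S, ι (M \ S)) = (11, 9)
    · -- branch Pc
      obtain ⟨⟨S₁, hS₁, hS₁t⟩, hno1⟩ := h2
      refine exists_odd_good_of_maxType a b c y C M ι hι 𝒮 h𝒮M 5 7 ⟨S₁, hS₁, (hpair S₁ 5 7).1 hS₁t⟩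
        (fun S hS => tables_branch_Pc.1 _ (htypes S hS) (fun h => hno1 ⟨S, hS, h⟩))
        (fun S hS hle1 hle2 => (hpair S 5 7).1 (tables_branch_Pc.2 _ (htypes S hS) hle1 hle2))
    · by_cases h3 : (∃ S ∈ 𝒮, (ι S, ι (M \ S)) = (6, 1)) ∧ ¬ ∃ S ∈ 𝒮, (ι S, ι (M \ S)) = (5, 7)
      · -- branch K5
        obtain ⟨⟨S₁, hS₁, hS₁t⟩, hnoc⟩ := h3
        refine exists_odd_good_of_maxType a b c y C M ι hι 𝒮 h𝒮M 6 1 ⟨S₁, hS₁, (hpair S₁ 6 1).1 hS₁t⟩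
          (fun S hS => tables_branch_K5.1 _ (htypes S hS) (fun h => hnoc ⟨S, hS, h⟩))
          (fun S hS hle1 hle2 => (hpair S 6 1).1 (tables_branch_K5.2 _ (htypes S hS) hle1 hle2))
      · -- now: (no Pb or some K5), (no Pc or some K1), (no K5 or some Pc)
        by_cases hPc : ∃ S ∈ 𝒮, (ι S, ι (M \ S)) = (5, 7)
        · -- Pc present ⇒ K1 present ⇒ (core B) no K5, no K4 ⇒ no Pb; types ⊆ {Pc, K1, K2, K4s}
          have hK1 : ∃ S ∈ 𝒮, (ι S, ι (M \ S)) = (11, 9) := by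
            by_contra h; exact h2 ⟨hPc, h⟩
          have hno54 : ¬ ∃ S ∈ 𝒮, (ι S, ι (M \ S)) = (6, 1) ∨ (ι S, ι (M \ S)) = (6, 8) :=
            fun h => hB ⟨hPc, hK1, h⟩
          have hnoPb : ¬ ∃ S ∈ 𝒮, (ι S, ι (M \ S)) = (6, 7) := by
            intro h; apply h1; exact ⟨h, fun ⟨S, hS, hSt⟩ => hno54 ⟨S, hS, Or.inl hSt⟩⟩
          refine exists_odd_good_PcK1K2K4s a b c y C M ι hι 𝒮 hne h𝒮M (fun S hS => ?_)
          rcases hmemP S hS with h | h | h | h | h | h | h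
          · exact absurd ⟨S, hS, h⟩ hnoPb
          · rw [h]; decide
          · rw [h]; decide
          · rw [h]; decide
          · exact absurd ⟨S, hS, Or.inr h⟩ hno54
          · exact absurd ⟨S, hS, Or.inl h⟩ hno54
          · rw [h]; decide
        · -- no Pc ⇒ no K5 ⇒ no Pb; types ⊆ {K1, K2, K4, K4s}
          have hnoK5 : ¬ ∃ S ∈ 𝒮, (ι S, ι (M \ S)) = (6, 1) := fun h => h3 ⟨h, hPc⟩
          have hnoPb : ¬ ∃ S ∈ 𝒮, (ι S, ι (M \ S)) = (6, 7) := fun h => h1 ⟨h, hnoK5⟩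
          by_cases h4s : ∃ S ∈ 𝒮, (ι S, ι (M \ S)) = (8, 1)
          · -- K4s present ⇒ (core A) no K4; types ⊆ {K1, K2, K4s}
            have hnoK4 : ¬ ∃ S ∈ 𝒮, (ι S, ι (M \ S)) = (6, 8) := fun h => hA ⟨h, h4s⟩
            refine exists_odd_good_PcK1K2K4s a b c y C M ι hι 𝒮 hne h𝒮M (fun S hS => ?_)
            rcases hmemP S hS with h | h | h | h | h | h | h
            · exact absurd ⟨S, hS, h⟩ hnoPb
            · exact absurd ⟨S, hS, h⟩ hPc
            · rw [h]; decide
            · rw [h]; decide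
            · exact absurd ⟨S, hS, h⟩ hnoK4
            · exact absurd ⟨S, hS, h⟩ hnoK5
            · rw [h]; decide
          · -- types ⊆ {K1, K2, K4}
            have hsub : ∀ S ∈ 𝒮, (ι S, ι (M \ S)) ∈ ({(11, 9), (11, 8), (6, 8)} : Finset (Fin 15 × Fin 15)) := by
              intro S hS
              rcases hmemP S hS with h | h | h | h | h | h | h
              · exact absurd ⟨S, hS, h⟩ hnoPb
              · exact absurd ⟨S, hS, h⟩ hPc
              · rw [h]; decide
              · rw [h]; decide
              · rw [h]; decide
              · exact absurd ⟨S, hS, h⟩ hnoK5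
              · exact absurd ⟨S, hS, h⟩ h4s
            obtain ⟨hT2c, hT2p, hT1c, hT1p, hT4⟩ := tables_branch_K1K2K4
            by_cases hK2 : ∃ S ∈ 𝒮, (ι S, ι (M \ S)) = (11, 8)
            · obtain ⟨S₁, hS₁, hS₁t⟩ := hK2
              exact exists_odd_good_of_maxType a b c y C M ι hι 𝒮 h𝒮M 11 8 ⟨S₁, hS₁, (hpair S₁ 11 8).1 hS₁t⟩
                (fun S hS => hT2c _ (hsub S hS)) (fun S hS hle1 hle2 => (hpair S 11 8).1 (hT2p _ (hsub S hS) hle1 hle2))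
            · have hsub' : ∀ S ∈ 𝒮, (ι S, ι (M \ S)) ∈ ({(11, 9), (6, 8)} : Finset (Fin 15 × Fin 15)) := by
                intro S hS
                have h := hsub S hS
                simp only [Finset.mem_insert, Finset.mem_singleton] at h ⊢
                rcases h with h | h | h
                · exact Or.inl h
                · exact absurd ⟨S, hS, h⟩ hK2
                · exact Or.inr h
              by_cases hK1 : ∃ S ∈ 𝒮, (ι S, ι (M \ S)) = (11, 9)
              · obtain ⟨S₁, hS₁, hS₁t⟩ := hK1
                exact exists_odd_good_of_maxType a b c y C M ι hι 𝒮 h𝒮M 11 9 ⟨S₁, hS₁, (hpair S₁ 11 9).1 hS₁t⟩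
                  (fun S hS => hT1c _ (hsub' S hS)) (fun S hS hle1 hle2 => (hpair S 11 9).1 (hT1p _ (hsub' S hS) hle1 hle2))
              · -- only K4-sides
                have hall : ∀ S ∈ 𝒮, ι S = 6 ∧ ι (M \ S) = 8 := by
                  intro S hS
                  have h := hsub' S hS
                  simp only [Finset.mem_insert, Finset.mem_singleton] at h
                  rcases h with h | h
                  · exact absurd ⟨S, hS, h⟩ hK1
                  · exact (hpair S 6 8).1 h
                obtain ⟨S₁, hS₁⟩ := hne
                exact exists_odd_good_of_maxType a b c y C M ι hι 𝒮 h𝒮M 6 8 ⟨S₁, hS₁, hall S₁ hS₁⟩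
                  (fun S hS => by rw [(hall S hS).1, (hall S hS).2]; exact hT4) (fun S hS _ _ => hall S hS)

end TwoCopyMono

end Summit.CriticalPhenomena.PercolationContinuityZ3.Theorems
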